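import Summits.QuantumAdvantage.AdviceFreeQNC0.CrossToProduct
import Literature.Computability.MetaComplexity.RobustHegedusLemma
import HarnessLib

/-!
# Cell qa-qnc0 — the product game of line `product`: fail patterns, potential costs, the minimum fail weight

Vocabulary of planner qa-qnc0-p1's line `product` of the route crux `RingToElim` (verbatim:
`IsElimFail`, `hdist`, `distFail`) and the lemmas of TARGET §17.1 that `stub_product`
(`LDMAPolylog → ElimHard → ProductHardPolylog`, file `ProductBound.lean`) needs, all PROVED:

* `rot0`, `elimFailBits_rot0`, `isElimFail_class0`, `isElimWin_class0` — re-staking brings every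
  target class to class `0` without changing the pattern or the degree (class shift = re-staking);
* `elimFailBits_xor3`, `isElimFail_xor3`, `isElimFail_true` — the fail patterns of a fixed degree
  form an AFFINE family: the sum of THREE fail patterns is a fail pattern; the abstaining stakes
  `(0,0)` fail everywhere;
* `distFail_le`, `exists_distFail_eq` — the potential cost `distFail D z = dist(z, 𝓕_D)` is attained;
* `potential_cost` — §17.1 Lemma 2: for a zero-sum triple `g₀ ⊕ g₁ ⊕ g₂ = 0`,
  `distFail D 0 ≤ Σ_r distFail D g_r`;
* `dec2`, `fail_of_dec2`, `le_distFail_zero` — under the crux hypothesis `ElimHard` (decoder form,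
  tree `Hegedus.wt`), every fail pattern of degree `≤ (log₂ ℓ)^C` has weight `≥ η₀·2^ℓ`, i.e.
  `w = distFail D 0 ≥ η₀ 2^ℓ` (a stakes-eliminator fails wherever the decoder naming its excluded
  class is right).
-/

namespace Summit.QuantumAdvantage.AdviceFreeQNC0

open Finset Literature.Computability.MetaComplexity Literature.Computability.MetaComplexity.Smolensky

variable {ℓ : ℕ}

/-! ### Vocabulary (verbatim from line `product`) -/

/-- `F` is the FAIL pattern of some stakes-eliminator of degree `≤ D` — the affine family
`𝓕_ℓ(D) = 𝟙 + C_ℓ(D)`. -/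
def IsElimFail {ℓ : ℕ} (D : ℕ) (F : (Fin ℓ → Bool) → Bool) : Prop :=
  ∃ c : ℕ, ∃ a b : (Fin ℓ → Bool) → Bool, HasDeg a D ∧ HasDeg b D ∧ ∀ v, F v = elimFail c a b v

/-- Hamming distance of two Boolean functions on the cube. -/
def hdist {ℓ : ℕ} (z F : (Fin ℓ → Bool) → Bool) : ℕ := (univ.filter fun v : Fin ℓ → Bool => z v ≠ F v).card

/-- `distFail D z` = Hamming distance from the row `z` to `𝓕_ℓ(D)` (the POTENTIAL COST of showing
row `z`). -/
noncomputable def distFail {ℓ : ℕ} (D : ℕ) (z : (Fin ℓ → Bool) → Bool) : ℕ :=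
  sInf {k : ℕ | ∃ F : (Fin ℓ → Bool) → Bool, IsElimFail D F ∧ hdist z F = k}

/-! ### Class `0` normal form (re-staking) -/

/-- Re-staked stakes bringing target class `c` to class `0`: identity, `(α ⊕ β, α)`, `(β, α ⊕ β)`
for `c ≡ 0, 1, 2`. -/
def rot0 (c : ℕ) (α β : Bool) : Bool × Bool :=
  if c % 3 = 0 then (α, β) else if c % 3 = 1 then (xor α β, α) else (β, xor α β)

/-- `rot0` depends on the class modulo `3`. -/
theorem rot0_mod (c : ℕ) (α β : Bool) : rot0 c α β = rot0 (c % 3) α β := by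
  unfold rot0; simp only [Nat.mod_mod]

/-- The re-staking law on residues (finite check). -/
private theorem rot0_law : ∀ r t : Fin 3, ∀ α β : Bool,
    elimFailBits r.val α β t.val = elimFailBits 0 (rot0 r.val α β).1 (rot0 r.val α β).2 t.val := by
  decide

/-- **Re-staking**: the class-`c` stakes `(α, β)` fail exactly where the class-`0` stakes
`rot0 c α β` fail. -/
theorem elimFailBits_rot0 (c : ℕ) (α β : Bool) (w : ℕ) :
    elimFailBits c α β w = elimFailBits 0 (rot0 c α β).1 (rot0 c α β).2 w := by
  rw [elimFailBits_mod c, rot0_mod c, elimFailBits_mod 0 _ _ w, Nat.zero_mod]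
  exact rot0_law ⟨c % 3, Nat.mod_lt _ (by norm_num)⟩ ⟨w % 3, Nat.mod_lt _ (by norm_num)⟩ α β

/-- Re-staking preserves the degree (first stake). -/
theorem hasDeg_rot0_fst {k D : ℕ} (c : ℕ) {a b : (Fin k → Bool) → Bool} (ha : HasDeg a D)
    (hb : HasDeg b D) : HasDeg (fun v => (rot0 c (a v) (b v)).1) D := by
  unfold rot0
  by_cases h0 : c % 3 = 0
  · simp only [h0, if_true]; exact ha
  · by_cases h1 : c % 3 = 1
    · simp only [h1, if_true]; exact hasDeg_xor ha hb
    · simp only [h0, h1, if_false]; exact hb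

/-- Re-staking preserves the degree (second stake). -/
theorem hasDeg_rot0_snd {k D : ℕ} (c : ℕ) {a b : (Fin k → Bool) → Bool} (ha : HasDeg a D)
    (hb : HasDeg b D) : HasDeg (fun v => (rot0 c (a v) (b v)).2) D := by
  unfold rot0
  by_cases h0 : c % 3 = 0
  · simp only [h0, if_true]; exact hb
  · by_cases h1 : c % 3 = 1
    · simp only [h1, if_true]; exact ha
    · simp only [h0, h1, if_false]; exact hasDeg_xor ha hb

/-- **Every fail pattern is a class-`0` fail pattern of the same degree.** -/
theorem isElimFail_class0 {D : ℕ} {F : (Fin ℓ → Bool) → Bool} (hF : IsElimFail D F) :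
    ∃ a b : (Fin ℓ → Bool) → Bool, HasDeg a D ∧ HasDeg b D ∧ ∀ v, F v = elimFail 0 a b v := by
  obtain ⟨c, a, b, ha, hb, hF⟩ := hF
  refine ⟨fun v => (rot0 c (a v) (b v)).1, fun v => (rot0 c (a v) (b v)).2,
    hasDeg_rot0_fst c ha hb, hasDeg_rot0_snd c ha hb, fun v => ?_⟩
  rw [hF v]
  exact elimFailBits_rot0 c (a v) (b v) (wt v)

/-- **Every win pattern is a class-`0` win pattern of the same degree.** -/
theorem isElimWin_class0 {D : ℕ} {h : (Fin ℓ → Bool) → Bool} (hh : IsElimWin D h) :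
    ∃ a b : (Fin ℓ → Bool) → Bool, HasDeg a D ∧ HasDeg b D ∧ ∀ u, h u = !(elimFail 0 a b u) := by
  obtain ⟨c, a, b, ha, hb, hh⟩ := hh
  refine ⟨fun v => (rot0 c (a v) (b v)).1, fun v => (rot0 c (a v) (b v)).2,
    hasDeg_rot0_fst c ha hb, hasDeg_rot0_snd c ha hb, fun u => ?_⟩
  rw [hh u]
  unfold elimFail
  rw [elimFailBits_rot0 c (a u) (b u) (wt u)]

/-! ### The fail family is affine -/

/-- The XOR law on residues (finite check). -/
private theorem xor3_law : ∀ t : Fin 3, ∀ α₁ β₁ α₂ β₂ α₃ β₃ : Bool,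
    xor (xor (elimFailBits 0 α₁ β₁ t.val) (elimFailBits 0 α₂ β₂ t.val)) (elimFailBits 0 α₃ β₃ t.val) =
      elimFailBits 0 (xor (xor α₁ α₂) α₃) (xor (xor β₁ β₂) β₃) t.val := by
  decide

/-- **Three class-`0` fail patterns sum to the fail pattern of the summed stakes.** -/
theorem elimFailBits_xor3 (α₁ β₁ α₂ β₂ α₃ β₃ : Bool) (w : ℕ) :
    xor (xor (elimFailBits 0 α₁ β₁ w) (elimFailBits 0 α₂ β₂ w)) (elimFailBits 0 α₃ β₃ w) =
      elimFailBits 0 (xor (xor α₁ α₂) α₃) (xor (xor β₁ β₂) β₃) w := by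
  rw [elimFailBits_mod 0 α₁, elimFailBits_mod 0 α₂, elimFailBits_mod 0 α₃,
    elimFailBits_mod 0 (xor (xor α₁ α₂) α₃), Nat.zero_mod]
  exact xor3_law ⟨w % 3, Nat.mod_lt _ (by norm_num)⟩ _ _ _ _ _ _

/-- **The sum of three fail patterns of degree `≤ D` is a fail pattern of degree `≤ D`.** -/
theorem isElimFail_xor3 {D : ℕ} {F₁ F₂ F₃ : (Fin ℓ → Bool) → Bool} (h₁ : IsElimFail D F₁)
    (h₂ : IsElimFail D F₂) (h₃ : IsElimFail D F₃) :
    IsElimFail D (fun v => xor (xor (F₁ v) (F₂ v)) (F₃ v)) := by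
  obtain ⟨a₁, b₁, ha₁, hb₁, e₁⟩ := isElimFail_class0 h₁
  obtain ⟨a₂, b₂, ha₂, hb₂, e₂⟩ := isElimFail_class0 h₂
  obtain ⟨a₃, b₃, ha₃, hb₃, e₃⟩ := isElimFail_class0 h₃
  refine ⟨0, fun v => xor (xor (a₁ v) (a₂ v)) (a₃ v), fun v => xor (xor (b₁ v) (b₂ v)) (b₃ v),
    hasDeg_xor (hasDeg_xor ha₁ ha₂) ha₃, hasDeg_xor (hasDeg_xor hb₁ hb₂) hb₃, fun v => ?_⟩
  show xor (xor (F₁ v) (F₂ v)) (F₃ v) =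
    elimFailBits 0 (xor (xor (a₁ v) (a₂ v)) (a₃ v)) (xor (xor (b₁ v) (b₂ v)) (b₃ v)) (wt v)
  rw [e₁ v, e₂ v, e₃ v]
  exact elimFailBits_xor3 _ _ _ _ _ _ (wt v)

/-- **The abstaining stakes `(0,0)` fail everywhere**: the all-`true` row is a fail pattern. -/
theorem isElimFail_true (D : ℕ) : IsElimFail D (fun _ : Fin ℓ → Bool => true) := by
  refine ⟨0, fun _ => false, fun _ => false, hasDeg_false D, hasDeg_false D, fun v => ?_⟩
  unfold elimFail
  rw [elimFailBits_mod]
  have key : ∀ t : Fin 3, elimFailBits 0 false false t.val = true := by decide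
  exact (key ⟨wt v % 3, Nat.mod_lt _ (by norm_num)⟩).symm

/-! ### Potential costs -/

/-- The potential cost is at most the distance to any fail pattern. -/
theorem distFail_le {D : ℕ} (z : (Fin ℓ → Bool) → Bool) {F : (Fin ℓ → Bool) → Bool}
    (hF : IsElimFail D F) : distFail D z ≤ hdist z F :=
  Nat.sInf_le ⟨F, hF, rfl⟩

/-- The potential cost is attained by some fail pattern. -/
theorem exists_distFail_eq (D : ℕ) (z : (Fin ℓ → Bool) → Bool) :
    ∃ F : (Fin ℓ → Bool) → Bool, IsElimFail D F ∧ hdist z F = distFail D z :=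
  Nat.sInf_mem (⟨hdist z fun _ => true, fun _ => true, isElimFail_true D, rfl⟩ :
    {k : ℕ | ∃ F : (Fin ℓ → Bool) → Bool, IsElimFail D F ∧ hdist z F = k}.Nonempty)

/-- **Potential-cost lemma** (TARGET §17.1 Lemma 2): for a zero-sum triple `g₀ ⊕ g₁ ⊕ g₂ = 0`,
`w = distFail D 0 ≤ distFail D g₀ + distFail D g₁ + distFail D g₂` (the three nearest fail
patterns sum to a fail pattern, which differs from `0` only where some `g_r` differs from its
`F_r`). -/
theorem potential_cost (D : ℕ) (g₀ g₁ g₂ : (Fin ℓ → Bool) → Bool)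
    (hsum : ∀ v, xor (xor (g₀ v) (g₁ v)) (g₂ v) = false) :
    distFail D (fun _ : Fin ℓ → Bool => false) ≤ distFail D g₀ + distFail D g₁ + distFail D g₂ := by
  obtain ⟨F₀, hF₀, e₀⟩ := exists_distFail_eq D g₀
  obtain ⟨F₁, hF₁, e₁⟩ := exists_distFail_eq D g₁
  obtain ⟨F₂, hF₂, e₂⟩ := exists_distFail_eq D g₂
  rw [← e₀, ← e₁, ← e₂]
  refine le_trans (distFail_le _ (isElimFail_xor3 hF₀ hF₁ hF₂)) ?_
  unfold hdist
  refine le_trans (card_le_card ?_) (le_trans (card_union_le _ _)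
    (add_le_add (card_union_le _ _) le_rfl))
  intro v hv
  simp only [mem_filter, mem_univ, true_and, mem_union] at hv ⊢
  have h := hsum v
  by_contra hne
  simp only [not_or, not_not] at hne
  obtain ⟨⟨h0, h1⟩, h2⟩ := hne
  apply hv
  rw [← h0, ← h1, ← h2, h]

/-! ### The minimum fail weight under `ElimHard` -/

/-- The decoder naming the class a pair of class-`0` stakes bets against:
`(1,0) ↦ 0`, `(0,1) ↦ 2`, `(1,1) ↦ 1`, abstention `(0,0) ↦ 0`. -/
def dec2 (α β : Bool) : ℕ := if α then (if β then 1 else 0) else (if β then 2 else 0)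

/-- **Where the decoder is right, the stakes fail.** -/
theorem fail_of_dec2 (α β : Bool) (w : ℕ) (h : dec2 α β % 3 = w % 3) :
    elimFailBits 0 α β w = true := by
  rw [elimFailBits_mod, Nat.zero_mod, ← h]
  cases α <;> cases β <;> decide

/-- The decoder in the `ZMod 2`-valued form of the crux hypothesis. -/
def dec2Z (x y : ZMod 2) : ℕ := dec2 (decide (x = 1)) (decide (y = 1))

/-- The `ZMod 2`-valued indicator of a Boolean function (`HasDeg f D` is `indZ f ∈ lowDeg _ _ D`). -/
def indZ {k : ℕ} (f : (Fin k → Bool) → Bool) : CubeFn (ZMod 2) k := fun u => if f u = true then 1 else 0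

/-- Indicator bookkeeping: the decoder reads the stakes off their indicators. -/
private theorem dec2Z_indZ {k : ℕ} (a b : (Fin k → Bool) → Bool) (u : Fin k → Bool) :
    dec2Z (indZ a u) (indZ b u) = dec2 (a u) (b u) := by
  unfold dec2Z indZ
  cases a u <;> cases b u <;> decide

/-- **`ElimHard` bounds the minimum fail weight**: if every degree-`≤ (log₂ n)^C` decoder-eliminator
on `n ≥ n₀` bits is wrong on `≥ η₀·2ⁿ` inputs, then every fail pattern of degree `≤ (log₂ ℓ)^C`,
`ℓ ≥ n₀`, has weight `≥ η₀·2^ℓ`: `η₀·2^ℓ ≤ distFail D 0`. -/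
theorem le_distFail_zero {η₀ : ℝ} {C n₀ : ℕ}
    (hE : ∀ n ≥ n₀, ∀ a b : CubeFn (ZMod 2) n,
      a ∈ lowDeg (ZMod 2) n ((Nat.log 2 n) ^ C) → b ∈ lowDeg (ZMod 2) n ((Nat.log 2 n) ^ C) →
        ∀ dec : ZMod 2 → ZMod 2 → ℕ,
          η₀ * (2 : ℝ) ^ n ≤ ((univ.filter fun u : Fin n → Bool =>
            dec (a u) (b u) % 3 = Hegedus.wt u % 3).card : ℝ))
    (hℓ : n₀ ≤ ℓ) {D : ℕ} (hD : D ≤ (Nat.log 2 ℓ) ^ C) :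
    η₀ * (2 : ℝ) ^ ℓ ≤ (distFail D (fun _ : Fin ℓ → Bool => false) : ℝ) := by
  obtain ⟨F, hF, hdF⟩ := exists_distFail_eq D (fun _ : Fin ℓ → Bool => false)
  obtain ⟨a, b, ha, hb, e⟩ := isElimFail_class0 hF
  have h := hE ℓ hℓ (indZ a) (indZ b) (lowDeg_mono hD ha) (lowDeg_mono hD hb) dec2Z
  rw [← hdF]
  refine le_trans h ?_
  unfold hdist
  exact_mod_cast card_le_card fun u hu => by
    have hu' : dec2Z (indZ a u) (indZ b u) % 3 = Hegedus.wt u % 3 := (Finset.mem_filter.1 hu).2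
    rw [dec2Z_indZ] at hu'
    refine Finset.mem_filter.2 ⟨Finset.mem_univ _, ?_⟩
    rw [e u]
    unfold elimFail
    rw [fail_of_dec2 (a u) (b u) (wt u) hu']
    exact Bool.false_ne_true

end Summit.QuantumAdvantage.AdviceFreeQNC0
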